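import Literature.Computability.Cryptography.CubicClassTableSemLadder
import HarnessLib

/-!
# Semantics of the class-group table, V: the greedy descent along the ladder

Topic `Computability/Cryptography`; theorem-only sequel of `CubicClassTableSemLadder.lean` (crux
`LinnikCubicClassGroups.PureCubicClassGroupFBQP`, line `arakelov-giant-step-cycle`). In the context of that file:

* `Inst.KInt_ge` — the defect bound `KInt = 2^prec (10 size(ab) + 48)` dominates `2^prec · 2 log(3√|d_K|) + 1`
  (and `2^prec`);
* `WalkFns.ladder_growth` — if the ladder base sits at `p₀ ≥ 2 KInt` then `(2^i + 1) KInt ≤ p_i` and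
  `2 p_i − KInt ≤ p_{i+1} ≤ 2 p_i + KInt`;
* `WalkFns.tryMul_sem` — one guarded multiplication by `g_m` towards `X`: it keeps a reduced label of the same ideal,
  never overshoots (`0 ≤ X − pos`), and either leaves the state unchanged (residual `< p_m + KInt`) or lowers the residual
  by `p_m ± KInt` while adding at most `2^m (s₀ + 1)` to the position error;
* `WalkFns.descend_level`, `WalkFns.descend_sem` — **the greedy descent**: from a reduced label of `A` at residual
  `0 ≤ X − pos ≤ ρ₀`, `ρ₀ < p_i + KInt` for all `i > L` (`L < Tdbl`), the state after `descend X` is a reduced label of `A`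
  with residual in `[0, p₀ + KInt)` and position error at most `e₀ + 3 (L + 1) 2^L (s₀ + 1)`.
[Buchmann–Williams 1988, §3; Hallgren 2005, §4]

## References

* J. Buchmann, H. C. Williams, Math. Comp. 50 (1988), §3. [BuchmannWilliams1988]
* S. Hallgren, STOC 2005, §4. [Hallgren2005]
-/

noncomputable section

namespace Literature.Computability.Cryptography

namespace CubicClassTable

open Literature.NumberTheory.CubicFields Literature.NumberTheory.CubicFields.PureCubicCodes
open Literature.NumberTheory.NumberFields.PureCubic (abs_discr_le ne_zero_of_squarefree_mul)
open scoped NumberField nonZeroDivisors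
open NumberField

/-- **The defect bound dominates one defect**: `2^prec (2 log(3√|d_K|)) + 1 ≤ KInt` and `2^prec ≤ KInt`
(`walkParams_bounds`: `2^prec (11 log(3√d) + 1) ≤ KInt`, `|d_K| ≤ 27a²b²`). [folklore] -/
theorem Inst.KInt_ge {K : Type*} [Field K] [NumberField K] {θ : K} {I : Inst} (hdeg : Module.finrank ℚ K = 3)
    (hab : Squarefree (I.a * I.b)) (hab1 : I.a * I.b ≠ 1) (hθ : θ ^ 3 = ((I.a * I.b ^ 2 : ℕ) : K))
    (hprec : 4 * Nat.size (I.a * I.b) + 8 ≤ I.prec) :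
    2 ^ I.prec * (2 * Real.log (3 * Real.sqrt |(discr K : ℝ)|)) + 1 ≤ (I.KInt : ℝ) ∧ (2 : ℝ) ^ I.prec ≤ (I.KInt : ℝ) ∧
      |(discr K : ℝ)| ≤ 2 ^ I.prec := by
  obtain ⟨ha, hb⟩ := ne_zero_of_squarefree_mul hab
  have hd0 : 0 < |(discr K : ℝ)| := by rw [← Int.cast_abs]; exact_mod_cast abs_pos.mpr (discr_ne_zero K)
  have hd27 : |(discr K : ℝ)| ≤ 27 * (I.a : ℝ) ^ 2 * (I.b : ℝ) ^ 2 := by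
    have h := abs_discr_le hdeg hab hab1 hθ
    rw [← Int.cast_abs]; exact_mod_cast h
  obtain ⟨-, hdp, hK, -⟩ := walkParams_bounds ha hb hprec hd0 hd27
  obtain ⟨hL0, -⟩ := WalkFns.logB_bounds (K := K)
  have hKI : (I.KInt : ℝ) = ((2 ^ I.prec * (10 * Nat.size (I.a * I.b) + 48) : ℕ) : ℝ) := by
    unfold Inst.KInt; push_cast; ring
  rw [hKI]
  have h1 : (1 : ℝ) ≤ 2 ^ I.prec := one_le_pow₀ (by norm_num)
  refine ⟨?_, ?_, hdp⟩ <;> nlinarith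

namespace WalkFns

section Descend

variable {K : Type*} [Field K] [NumberField K] {θ : K} {σ₁ : K →+* ℝ} {σ₂ : K →+* ℂ} {F : WalkFns} {I : Inst}
variable (hdeg : Module.finrank ℚ K = 3) (hσ₂ : ∃ z : K, starRingEnd ℂ (σ₂ z) ≠ σ₂ z)
  (ε : (𝓞 K)ˣ) (hε : 1 < σ₁ (algebraMap (𝓞 K) K ε))
  (hab : Squarefree (I.a * I.b)) (hab1 : I.a * I.b ≠ 1) (hθ : θ ^ 3 = ((I.a * I.b ^ 2 : ℕ) : K))
  (hred : RedSem F I.a I.b K θ σ₁ σ₂) (hprod : ProdSpec I.a I.b K θ F.latProd)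
  {cap : ℕ} (hcap : (243 * I.a ^ 2 * I.b ^ 2) ^ 2 ≤ cap) (hprec : 4 * Nat.size (I.a * I.b) + 8 ≤ I.prec)
  (hord : Canon I.ord) (hordm : ∀ φ : K, Mem θ I.b I.ord φ ↔ IsIntegral ℤ φ)

include hdeg hσ₂ hε hab hab1 hθ hred hprod hcap hprec hord hordm in
/-- **Growth of the ladder positions**: from `p₀ ≥ 2 KInt`, `(2^i + 1) KInt ≤ p_i` and `|p_{i+1} − 2 p_i| ≤ KInt`.
[cite: BuchmannWilliams1988, §3] -/
theorem ladder_growth (h0 : 2 * (I.KInt : ℝ) ≤ (F.ladder I cap 0).2) (i : ℕ) :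
    (2 ^ i + 1) * (I.KInt : ℝ) ≤ (F.ladder I cap i).2 ∧
      |((F.ladder I cap (i + 1)).2 : ℝ) - 2 * (F.ladder I cap i).2| ≤ I.KInt := by
  obtain ⟨hK, -, -⟩ := Inst.KInt_ge (I := I) hdeg hab hab1 hθ hprec
  have hstep : ∀ j, |((F.ladder I cap (j + 1)).2 : ℝ) - 2 * (F.ladder I cap j).2| ≤ I.KInt := fun j => by
    obtain ⟨-, -, -, -, -, -, h⟩ := ladder_sem hdeg hσ₂ ε hε hab hab1 hθ hred hprod hcap hprec hord hordm j
    exact h.trans hK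
  refine ⟨?_, hstep i⟩
  induction i with
  | zero => norm_num; linarith
  | succ i ih =>
    have h := hstep i
    rw [abs_le] at h
    have e : (2 : ℝ) ^ (i + 1) = 2 * 2 ^ i := by ring
    nlinarith [h.1, ih]

include hdeg hσ₂ hε hab hab1 hθ hred hprod hcap hprec hord hordm in
/-- **One guarded multiplication** by the ladder element `g_m` towards `X`: the state stays a reduced label of `A`; the
residual `X − pos` stays `≥ 0`; either nothing happens (and then `X − pos < p_m + KInt`), or the residual drops by
`p_m + l`, `|l| ≤ KInt`, and the position error grows by at most `2^m (s₀ + 1)`. [cite: BuchmannWilliams1988, §3] -/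
theorem tryMul_sem (X : ℤ) (m : ℕ) {st : PLat} {A : FractionalIdeal (𝓞 K)⁰ K} {α : K} (hα : 0 < σ₁ α)
    (hc : Canon st.1) (hm : ∀ φ : K, Mem θ I.b st.1 φ ↔ φ ∈ FractionalIdeal.spanSingleton (𝓞 K)⁰ α⁻¹ * A)
    (h1 : (1 : K) ∈ posRelMinima σ₁ σ₂ (FractionalIdeal.spanSingleton (𝓞 K)⁰ α⁻¹ * A)) {e : ℝ}
    (herr : |(st.2 : ℝ) - 2 ^ I.prec * Real.log (σ₁ α)| ≤ e) (hρ : 0 ≤ X - st.2) :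
    ∃ α' : K, 0 < σ₁ α' ∧ Canon (F.tryMul I cap X m st).1 ∧
      (∀ φ : K, Mem θ I.b (F.tryMul I cap X m st).1 φ ↔ φ ∈ FractionalIdeal.spanSingleton (𝓞 K)⁰ α'⁻¹ * A) ∧
      (1 : K) ∈ posRelMinima σ₁ σ₂ (FractionalIdeal.spanSingleton (𝓞 K)⁰ α'⁻¹ * A) ∧
      0 ≤ X - (F.tryMul I cap X m st).2 ∧
      ((F.tryMul I cap X m st = st ∧ α' = α ∧ ((X - st.2 : ℤ) : ℝ) < (F.ladder I cap m).2 + I.KInt) ∨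
       ((F.ladder I cap m).2 + (I.KInt : ℝ) ≤ ((X - st.2 : ℤ) : ℝ) ∧
        |((F.tryMul I cap X m st).2 : ℝ) - st.2 - (F.ladder I cap m).2| ≤ I.KInt ∧
        |((F.tryMul I cap X m st).2 : ℝ) - 2 ^ I.prec * Real.log (σ₁ α')| ≤ e + 2 ^ m * (I.s₀ + 1))) := by
  obtain ⟨hK, -, -⟩ := Inst.KInt_ge (I := I) hdeg hab hab1 hθ hprec
  by_cases hg : st.2 + (F.ladder I cap m).2 + I.KInt ≤ X
  · -- the multiplication fires
    have hT : F.tryMul I cap X m st = F.starCc I cap st (F.ladder I cap m) := by unfold tryMul; rw [if_pos hg]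
    obtain ⟨η, hη, hcl, hml, honel, herrl, -⟩ := ladder_sem hdeg hσ₂ ε hε hab hab1 hθ hred hprod hcap hprec hord hordm m
    obtain ⟨γ, hγ, hcan, hmem, hone, hl, hlg⟩ :=
      starCc_mul_sem hdeg hσ₂ hab hab1 hθ hred hprod hcap hprec hc hm h1 hcl hml honel
    rw [mul_one] at hmem hone
    have hg' : ((st.2 : ℤ) : ℝ) + (F.ladder I cap m).2 + I.KInt ≤ X := by exact_mod_cast hg
    have hl' := hl
    rw [abs_le] at hl' hlg
    have hlK : |((F.starCc I cap st (F.ladder I cap m)).2 : ℝ) - st.2 - (F.ladder I cap m).2| ≤ I.KInt := by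
      have e1 : ((F.starCc I cap st (F.ladder I cap m)).2 : ℝ) - st.2 - (F.ladder I cap m).2 =
          (((F.starCc I cap st (F.ladder I cap m)).2 - st.2 - (F.ladder I cap m).2 : ℤ) : ℝ) := by push_cast; ring
      rw [e1, abs_le]
      have h2 : (0 : ℝ) ≤ 2 ^ I.prec := by positivity
      constructor <;> nlinarith [hl'.1, hl'.2, hlg.1, hlg.2, h2]
    have hlK' := hlK
    rw [abs_le] at hlK'
    refine ⟨α * η * γ, by rw [map_mul, map_mul]; positivity, hT ▸ hcan, fun φ => by rw [hT]; exact hmem φ, hone, ?_,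
      Or.inr ⟨by push_cast; linarith, hT ▸ hlK, ?_⟩⟩
    · rw [hT]
      have h' : ((F.starCc I cap st (F.ladder I cap m)).2 : ℝ) ≤ X := by linarith [hlK'.2]
      have h'' : (F.starCc I cap st (F.ladder I cap m)).2 ≤ X := by exact_mod_cast h'
      linarith
    · rw [hT]
      have hlog : Real.log (σ₁ (α * η * γ)) = Real.log (σ₁ α) + Real.log (σ₁ η) + Real.log (σ₁ γ) := by
        rw [map_mul, map_mul, Real.log_mul (by positivity) hγ.ne', Real.log_mul hα.ne' hη.ne']
      rw [hlog]
      have e1 : ((F.starCc I cap st (F.ladder I cap m)).2 : ℝ) =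
          (((F.starCc I cap st (F.ladder I cap m)).2 - st.2 - (F.ladder I cap m).2 : ℤ) : ℝ) + st.2 + (F.ladder I cap m).2 := by
        push_cast; ring
      rw [e1, abs_le]
      rw [abs_le] at herr herrl
      push_cast at herr herrl hl' ⊢
      constructor <;> linarith [herr.1, herr.2, herrl.1, herrl.2, hl'.1, hl'.2]
  · have hT : F.tryMul I cap X m st = st := by unfold tryMul; rw [if_neg hg]
    refine ⟨α, hα, by rw [hT]; exact hc, fun φ => by rw [hT]; exact hm φ, h1, by rw [hT]; exact hρ, Or.inl ⟨hT, rfl, ?_⟩⟩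
    push Not at hg
    have : ((X : ℤ) : ℝ) < st.2 + (F.ladder I cap m).2 + I.KInt := by exact_mod_cast hg
    push_cast; linarith


include hdeg hσ₂ hε hab hab1 hθ hred hprod hcap hprec hord hordm in
/-- **One level of the descent** (three guarded multiplications by `g_m`): entering with residual `< p_{m+1} + KInt` the
state leaves with residual `< p_m + KInt`; levels `m > L` (where `ρ₀ < p_m + KInt`) never fire, the others add at most
`3 · 2^L (s₀ + 1)` to the position error. [cite: BuchmannWilliams1988, §3] -/
theorem descend_level (h0 : 2 * (I.KInt : ℝ) ≤ (F.ladder I cap 0).2) {L : ℕ} {ρ₀ : ℝ}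
    (hL : ∀ i, L < i → ρ₀ < (F.ladder I cap i).2 + I.KInt) (X : ℤ) (m : ℕ)
    {st : PLat} {A : FractionalIdeal (𝓞 K)⁰ K} {α : K} (hα : 0 < σ₁ α)
    (hc : Canon st.1) (hm : ∀ φ : K, Mem θ I.b st.1 φ ↔ φ ∈ FractionalIdeal.spanSingleton (𝓞 K)⁰ α⁻¹ * A)
    (h1 : (1 : K) ∈ posRelMinima σ₁ σ₂ (FractionalIdeal.spanSingleton (𝓞 K)⁰ α⁻¹ * A)) {e : ℝ}
    (herr : |(st.2 : ℝ) - 2 ^ I.prec * Real.log (σ₁ α)| ≤ e) (hρ : 0 ≤ X - st.2) (hρ₀ : ((X - st.2 : ℤ) : ℝ) ≤ ρ₀)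
    (hentry : ((X - st.2 : ℤ) : ℝ) < (F.ladder I cap (m + 1)).2 + I.KInt) :
    ∃ α' : K, 0 < σ₁ α' ∧ Canon ((F.tryMul I cap X m)^[3] st).1 ∧
      (∀ φ : K, Mem θ I.b ((F.tryMul I cap X m)^[3] st).1 φ ↔ φ ∈ FractionalIdeal.spanSingleton (𝓞 K)⁰ α'⁻¹ * A) ∧
      (1 : K) ∈ posRelMinima σ₁ σ₂ (FractionalIdeal.spanSingleton (𝓞 K)⁰ α'⁻¹ * A) ∧
      0 ≤ X - ((F.tryMul I cap X m)^[3] st).2 ∧ ((X - ((F.tryMul I cap X m)^[3] st).2 : ℤ) : ℝ) ≤ ρ₀ ∧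
      ((X - ((F.tryMul I cap X m)^[3] st).2 : ℤ) : ℝ) < (F.ladder I cap m).2 + I.KInt ∧
      |(((F.tryMul I cap X m)^[3] st).2 : ℝ) - 2 ^ I.prec * Real.log (σ₁ α')| ≤
        e + 3 * (if m ≤ L then 2 ^ L * ((I.s₀ : ℝ) + 1) else 0) := by
  obtain ⟨hpm, hpm1⟩ := ladder_growth hdeg hσ₂ ε hε hab hab1 hθ hred hprod hcap hprec hord hordm h0 m
  obtain ⟨-, hK1, -⟩ := Inst.KInt_ge (I := I) hdeg hab hab1 hθ hprec
  have hK0 : (0 : ℝ) ≤ I.KInt := le_trans (by positivity) hK1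
  have h2i : (1 : ℝ) ≤ 2 ^ m := one_le_pow₀ (by norm_num)
  have hpm2 : 2 * (I.KInt : ℝ) ≤ (F.ladder I cap m).2 := by nlinarith
  rw [abs_le] at hpm1
  set E : ℝ := if m ≤ L then 2 ^ L * ((I.s₀ : ℝ) + 1) else 0 with hE
  have hE0 : 0 ≤ E := by rw [hE]; split_ifs <;> positivity
  set ρ : ℝ := ((X - st.2 : ℤ) : ℝ) with hρdef
  -- the invariant after `k` guarded multiplications
  set Q : ℕ → PLat → Prop := fun k st' => ∃ α' : K, 0 < σ₁ α' ∧ Canon st'.1 ∧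
      (∀ φ : K, Mem θ I.b st'.1 φ ↔ φ ∈ FractionalIdeal.spanSingleton (𝓞 K)⁰ α'⁻¹ * A) ∧
      (1 : K) ∈ posRelMinima σ₁ σ₂ (FractionalIdeal.spanSingleton (𝓞 K)⁰ α'⁻¹ * A) ∧
      0 ≤ X - st'.2 ∧ ((X - st'.2 : ℤ) : ℝ) ≤ ρ₀ ∧
      |(st'.2 : ℝ) - 2 ^ I.prec * Real.log (σ₁ α')| ≤ e + k * E ∧
      (((X - st'.2 : ℤ) : ℝ) < (F.ladder I cap m).2 + I.KInt ∨
        ((X - st'.2 : ℤ) : ℝ) + k * ((F.ladder I cap m).2 - I.KInt) ≤ ρ) with hQ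
  have hQ0 : Q 0 st := ⟨α, hα, hc, hm, h1, hρ, hρ₀, by simpa using herr, Or.inr (by simp [hρdef])⟩
  have hstep : ∀ k st', Q k st' → Q (k + 1) (F.tryMul I cap X m st') := by
    rintro k st' ⟨α', hα', hc', hm', h1', hρ', hρ₀', herr', hdisj⟩
    obtain ⟨α'', hα'', hc'', hm'', h1'', hρ'', hcase⟩ :=
      tryMul_sem hdeg hσ₂ ε hε hab hab1 hθ hred hprod hcap hprec hord hordm X m hα' hc' hm' h1' herr' hρ'
    rcases hcase with ⟨hT, hαeq, hlt⟩ | ⟨hfire, hl, herr''⟩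
    · refine ⟨α'', hα'', hc'', hm'', h1'', hρ'', by rw [hT]; exact hρ₀', ?_, Or.inl (by rw [hT]; exact hlt)⟩
      rw [hT, hαeq]; push_cast; nlinarith [herr', hE0]
    · -- the multiplication fired: `m ≤ L`
      have hmL : m ≤ L := by
        by_contra hcon
        push Not at hcon
        have := hL m hcon
        linarith
      have hEm : (2 : ℝ) ^ m * ((I.s₀ : ℝ) + 1) ≤ E := by
        rw [hE, if_pos hmL]
        exact mul_le_mul_of_nonneg_right (pow_le_pow_right₀ (by norm_num) hmL) (by positivity)
      rw [abs_le] at hl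
      have hρnew : ((X - (F.tryMul I cap X m st').2 : ℤ) : ℝ) ≤ ((X - st'.2 : ℤ) : ℝ) - (F.ladder I cap m).2 + I.KInt := by
        push_cast at hl ⊢; linarith [hl.1]
      refine ⟨α'', hα'', hc'', hm'', h1'', hρ'', by linarith, ?_, ?_⟩
      · push_cast at herr'' ⊢; nlinarith [herr'', hEm]
      · rcases hdisj with hlt | hsum
        · exact absurd hfire (not_le.mpr hlt)
        · right; push_cast at hsum hρnew ⊢; nlinarith [hsum, hρnew]
  have hQ3 : Q 3 ((F.tryMul I cap X m)^[3] st) := by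
    have h1' := hstep 0 _ hQ0
    have h2' := hstep 1 _ h1'
    have h3' := hstep 2 _ h2'
    simpa [Function.iterate_succ_apply'] using h3'
  obtain ⟨α', hα', hc', hm', h1', hρ', hρ₀', herr', hdisj⟩ := hQ3
  refine ⟨α', hα', hc', hm', h1', hρ', hρ₀', ?_, by simpa using herr'⟩
  rcases hdisj with hlt | hsum
  · exact hlt
  · -- three firings from `ρ < 2 p_m + 2 KInt` leave `< 5 KInt − p_m ≤ p_m + KInt`
    have hent : ρ < 2 * (F.ladder I cap m).2 + 2 * I.KInt := by rw [hρdef]; linarith [hpm1.2]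
    push_cast at hsum ⊢
    nlinarith [hsum, hent, hpm2]

include hdeg hσ₂ hε hab hab1 hθ hred hprod hcap hprec hord hordm in
/-- **The greedy descent, windowed**: processing the levels `i + k − 1, …, i`. [cite: BuchmannWilliams1988, §3] -/
theorem descend_window (h0 : 2 * (I.KInt : ℝ) ≤ (F.ladder I cap 0).2) {L : ℕ} {ρ₀ : ℝ}
    (hL : ∀ i, L < i → ρ₀ < (F.ladder I cap i).2 + I.KInt) (X : ℤ) (A : FractionalIdeal (𝓞 K)⁰ K) (e : ℝ) :
    ∀ (k i : ℕ) (st : PLat),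
      (∃ α : K, 0 < σ₁ α ∧ Canon st.1 ∧
        (∀ φ : K, Mem θ I.b st.1 φ ↔ φ ∈ FractionalIdeal.spanSingleton (𝓞 K)⁰ α⁻¹ * A) ∧
        (1 : K) ∈ posRelMinima σ₁ σ₂ (FractionalIdeal.spanSingleton (𝓞 K)⁰ α⁻¹ * A) ∧
        0 ≤ X - st.2 ∧ ((X - st.2 : ℤ) : ℝ) ≤ ρ₀ ∧ ((X - st.2 : ℤ) : ℝ) < (F.ladder I cap (i + k)).2 + I.KInt ∧
        |(st.2 : ℝ) - 2 ^ I.prec * Real.log (σ₁ α)| ≤ e + 3 * ((L + 1 - (i + k) : ℕ) : ℝ) * (2 ^ L * ((I.s₀ : ℝ) + 1))) →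
      ∃ α : K, 0 < σ₁ α ∧ Canon (((List.range' i k).reverse).foldl (fun acc j => (F.tryMul I cap X j)^[3] acc) st).1 ∧
        (∀ φ : K, Mem θ I.b (((List.range' i k).reverse).foldl (fun acc j => (F.tryMul I cap X j)^[3] acc) st).1 φ ↔
          φ ∈ FractionalIdeal.spanSingleton (𝓞 K)⁰ α⁻¹ * A) ∧
        (1 : K) ∈ posRelMinima σ₁ σ₂ (FractionalIdeal.spanSingleton (𝓞 K)⁰ α⁻¹ * A) ∧
        0 ≤ X - (((List.range' i k).reverse).foldl (fun acc j => (F.tryMul I cap X j)^[3] acc) st).2 ∧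
        ((X - (((List.range' i k).reverse).foldl (fun acc j => (F.tryMul I cap X j)^[3] acc) st).2 : ℤ) : ℝ) ≤ ρ₀ ∧
        ((X - (((List.range' i k).reverse).foldl (fun acc j => (F.tryMul I cap X j)^[3] acc) st).2 : ℤ) : ℝ) <
          (F.ladder I cap i).2 + I.KInt ∧
        |((((List.range' i k).reverse).foldl (fun acc j => (F.tryMul I cap X j)^[3] acc) st).2 : ℝ) -
            2 ^ I.prec * Real.log (σ₁ α)| ≤ e + 3 * ((L + 1 - i : ℕ) : ℝ) * (2 ^ L * ((I.s₀ : ℝ) + 1)) := by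
  intro k
  induction k with
  | zero =>
    intro i st h
    simpa using h
  | succ k ih =>
    rintro i st ⟨α, hα, hc, hm, h1, hρ, hρ₀, hent, herr⟩
    have hsplit : (List.range' i (k + 1)).reverse = (i + k) :: (List.range' i k).reverse := by
      rw [List.range'_concat, List.reverse_append]; simp
    rw [hsplit, List.foldl_cons]
    apply ih
    rw [show i + (k + 1) = i + k + 1 by ring] at hent herr
    obtain ⟨α', hα', hc', hm', h1', hρ', hρ₀', hlt, herr'⟩ :=
      descend_level hdeg hσ₂ ε hε hab hab1 hθ hred hprod hcap hprec hord hordm h0 hL X (i + k) hα hc hm h1 herr hρ hρ₀ hent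
    refine ⟨α', hα', hc', hm', h1', hρ', hρ₀', hlt, herr'.trans ?_⟩
    have hs0 : (0 : ℝ) ≤ 2 ^ L * ((I.s₀ : ℝ) + 1) := by positivity
    split_ifs with hle
    · have : ((L + 1 - (i + k) : ℕ) : ℝ) = ((L + 1 - (i + k + 1) : ℕ) : ℝ) + 1 := by
        rw [← Nat.cast_succ]; congr 1; omega
      rw [this]; nlinarith
    · have : ((L + 1 - (i + k) : ℕ) : ℝ) = ((L + 1 - (i + k + 1) : ℕ) : ℝ) := by
        congr 1; omega
      rw [this]; linarith

include hdeg hσ₂ hε hab hab1 hθ hred hprod hcap hprec hord hordm in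
/-- **The greedy descent**: from a reduced label `st ~ α⁻¹ A` with residual `0 ≤ X − pos ≤ ρ₀`, where `ρ₀ < p_i + KInt`
for all levels `i > L` (`L < Tdbl`) and the ladder base sits at `p₀ ≥ 2 KInt`, the state `descend X st` is a reduced label
of `A` with residual in `[0, p₀ + KInt)` and position error at most `e + 3 (L + 1) 2^L (s₀ + 1)`.
[cite: BuchmannWilliams1988, §3] -/
theorem descend_sem (h0 : 2 * (I.KInt : ℝ) ≤ (F.ladder I cap 0).2) {L : ℕ} (hLT : L < I.Tdbl) {ρ₀ : ℝ}
    (hL : ∀ i, L < i → ρ₀ < (F.ladder I cap i).2 + I.KInt) (X : ℤ) {st : PLat} {A : FractionalIdeal (𝓞 K)⁰ K}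
    {α : K} (hα : 0 < σ₁ α) (hc : Canon st.1)
    (hm : ∀ φ : K, Mem θ I.b st.1 φ ↔ φ ∈ FractionalIdeal.spanSingleton (𝓞 K)⁰ α⁻¹ * A)
    (h1 : (1 : K) ∈ posRelMinima σ₁ σ₂ (FractionalIdeal.spanSingleton (𝓞 K)⁰ α⁻¹ * A)) {e : ℝ}
    (herr : |(st.2 : ℝ) - 2 ^ I.prec * Real.log (σ₁ α)| ≤ e) (hρ : 0 ≤ X - st.2) (hρ₀ : ((X - st.2 : ℤ) : ℝ) ≤ ρ₀) :
    ∃ α' : K, 0 < σ₁ α' ∧ Canon (F.descend I cap X st).1 ∧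
      (∀ φ : K, Mem θ I.b (F.descend I cap X st).1 φ ↔ φ ∈ FractionalIdeal.spanSingleton (𝓞 K)⁰ α'⁻¹ * A) ∧
      (1 : K) ∈ posRelMinima σ₁ σ₂ (FractionalIdeal.spanSingleton (𝓞 K)⁰ α'⁻¹ * A) ∧
      0 ≤ X - (F.descend I cap X st).2 ∧
      ((X - (F.descend I cap X st).2 : ℤ) : ℝ) < (F.ladder I cap 0).2 + I.KInt ∧
      |((F.descend I cap X st).2 : ℝ) - 2 ^ I.prec * Real.log (σ₁ α')| ≤ e + 3 * (L + 1) * (2 ^ L * ((I.s₀ : ℝ) + 1)) := by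
  have h := descend_window hdeg hσ₂ ε hε hab hab1 hθ hred hprod hcap hprec hord hordm h0 hL X A e I.Tdbl 0 st
    ⟨α, hα, hc, hm, h1, hρ, hρ₀, by rw [zero_add]; exact lt_of_le_of_lt hρ₀ (hL _ hLT), by
      rw [show (L + 1 - (0 + I.Tdbl) : ℕ) = 0 by omega]; simpa using herr⟩
  obtain ⟨α', hα', hc', hm', h1', hρ', -, hlt, herr'⟩ := h
  have hfold : F.descend I cap X st = ((List.range' 0 I.Tdbl).reverse).foldl (fun acc j => (F.tryMul I cap X j)^[3] acc) st := by
    unfold descend; rw [List.range_eq_range']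
  refine ⟨α', hα', hfold ▸ hc', fun φ => by rw [hfold]; exact hm' φ, h1', by rw [hfold]; exact hρ', by rw [hfold]; exact hlt, ?_⟩
  rw [hfold]
  simpa using herr'

end Descend

end WalkFns


section Summary

/-- **Summary (registered helper of the class-group stage)**: the greedy descent along the ladder. [cite: BuchmannWilliams1988, §3] -/
theorem cubicClassTable_descend_sem : ∀ (K : Type) [Field K] [NumberField K], Module.finrank ℚ K = 3 → ∀ (θ : K) (σ₁ : K →+* ℝ) (σ₂ : K →+* ℂ), (∃ z : K, starRingEnd ℂ (σ₂ z) ≠ σ₂ z) → ∀ (ε : (𝓞 K)ˣ), 1 < σ₁ (algebraMap (𝓞 K) K ε) → ∀ (F : CubicClassTable.WalkFns) (I : CubicClassTable.Inst), Squarefree (I.a * I.b) → I.a * I.b ≠ 1 → θ ^ 3 = ((I.a * I.b ^ 2 : ℕ) : K) → CubicClassTable.RedSem F I.a I.b K θ σ₁ σ₂ → CubicClassTable.ProdSpec I.a I.b K θ F.latProd → ∀ (cap : ℕ), (243 * I.a ^ 2 * I.b ^ 2) ^ 2 ≤ cap → 4 * Nat.size (I.a * I.b) + 8 ≤ I.prec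 → PureCubicCodes.Canon I.ord → (∀ φ : K, PureCubicCodes.Mem θ I.b I.ord φ ↔ IsIntegral ℤ φ) → 2 * (I.KInt : ℝ) ≤ (F.ladder I cap 0).2 → ∀ (L : ℕ), L < I.Tdbl → ∀ (ρ₀ : ℝ), (∀ i, L < i → ρ₀ < (F.ladder I cap i).2 + I.KInt) → ∀ (X : ℤ) (st : (ℕ × List ℤ) × ℤ) (A : FractionalIdeal (𝓞 K)⁰ K) (α : K), 0 < σ₁ α → PureCubicCodes.Canon st.1 → (∀ φ : K, PureCubicCodes.Mem θ I.b st.1 φ ↔ φ ∈ FractionalIdeal.spanSingleton (𝓞 K)⁰ α⁻¹ * A) → (1 : K) ∈ posRelMinima σ₁ σ₂ (FractionalIdeal.spanSingleton (𝓞 K)⁰ α⁻¹ * A) → ∀ (e : ℝ), |(st.2 : ℝ) - 2 ^ I.prec * Real.log (σ₁ α)| ≤ e → 0 ≤ X - st.2 → ((X - st.2 : ℤ) : ℝ) ≤ ρ₀ → ∃ α' : K, 0 < σ₁ α' ∧ PureCubicCodes.Canon (F.descend I cap X st).1 ∧ (∀ φ : K, PureCubicCodes.Mem θ I.b (F.descend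 I cap X st).1 φ ↔ φ ∈ FractionalIdeal.spanSingleton (𝓞 K)⁰ α'⁻¹ * A) ∧ (1 : K) ∈ posRelMinima σ₁ σ₂ (FractionalIdeal.spanSingleton (𝓞 K)⁰ α'⁻¹ * A) ∧ 0 ≤ X - (F.descend I cap X st).2 ∧ ((X - (F.descend I cap X st).2 : ℤ) : ℝ) < (F.ladder I cap 0).2 + I.KInt ∧ |((F.descend I cap X st).2 : ℝ) - 2 ^ I.prec * Real.log (σ₁ α')| ≤ e + 3 * (L + 1) * (2 ^ L * ((I.s₀ : ℝ) + 1)) :=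
  fun _ _ _ hdeg _ _ _ hσ₂ ε hε _ _ hab hab1 hθ hred hprod _ hcap hprec hord hordm h0 _ hLT _ hL X _ _ _ hα hc hm h1 _ herr hρ hρ₀ =>
    WalkFns.descend_sem hdeg hσ₂ ε hε hab hab1 hθ hred hprod hcap hprec hord hordm h0 hLT hL X hα hc hm h1 herr hρ hρ₀

end Summary

end CubicClassTable

end Literature.Computability.Cryptography
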